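import Mathlib
import Literature.AlgebraicGeometry.Resolution.PointBlowupFlagShiftBound
import Literature.RingTheory.MvPowerSeries.HasseDerivFrobeniusPow
import Summits.ResolutionOfSingularities.ResolutionOfSingularities.Theorems.WeightedInvariantLocalWeightedDropWildMonicKangarooDefs

/-!
# `WeightedInvariant.LocalWeightedDrop`, line `hasse-ridge-face-selection`, S3ρ sub-stub S3ρD₂ `stub_wildMonicSurfaceDescent₂`:
# CASE D-d (KANGAROO), part 3 — the FLATTENING CALCULUS: weighted-homogeneous two-variable forms as one-variable polynomials
# (orders, Hasse derivatives, and the twist to the subordinate coordinates)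

Crux item stmt-ResolutionOfSingularities-8899 `LocalWeightedDrop` (route `ResolutionOfSingularities/WeightedInvariant`), engine of the
door `HypersurfaceCentreConstruction` stmt-ResolutionOfSingularities-19897.  [OURS · L1 W4.3, chain w43, seat res-type-056 on ROADMAP item
(C8) = D-d KANGAROO of `L/res-L1-w43-stub-7/S3RHOD-ROADMAP.md`.  MODEL: S. Perlega, thesis Wien 2017 / arXiv:2011.14443, Ch. 6 §2.1
[cite: Perlega2020, Lemma 6.2.1 (3)(4)(5), proof of Prop. 6.2.3 («`in_w(f̃_i) = in_w(f_i)`», «`ord_{(y_1)} ∂_{y_1^r}(in_w(f_{c−q})) …`»)]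
and H. Hauser, S. Perlega, Publ. RIMS 60 (2024) Lemma 2 p. 789 («`F = in_ω(F)(x, y₁ − t xⁿ) + K`, `ω₁(K) > ω₁(F)`»), whose series-level
weight-line computation is res-lit-5's `HauserPerlega2024.coeff_subst_triangular_of_weight_le` (p497145) — IMPORTED here, not re-derived.
Nothing here is a statement of H. Hironaka's manuscript [claim: Hironaka2017, status: under-review]; OUR lemmas about OUR objects
(`WildMonic.inW`, `flatPoly`, `twist` of `…WildMonicKangarooDefs`).]

DICTIONARY (letters `x ≠ y`, weight `w x = 1`, `w y = n ≥ 1`; `G` `w`-homogeneous of weight `W`, `P = flatPoly x y n W G`): `coeff_eq_coeff_flatPoly`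
(`G = Σ_j P_j x^{W−nj} y^j`); `weightedOrder_single_eq_natTrailingDegree` (`ord_{(y)} G = tdeg P`); `isWeightedHomogeneous_hasseDeriv_single` /
`flatPoly_hasseDeriv_single` (`∂_{y^k} G` has weight `W − nk` and flattens to `Polynomial.hasseDeriv k P`); `weightedOrder_single_le_hasseDeriv_add`
(Lemma 6.2.1 (3): `ord_{(y)} F ≤ ord_{(y)} ∂_{y^k} F + k`); `twist_eq_substFree` / `coeff_subst_twist_of_weight_le` (the twist is HP's triangular
substitution with `φ = −t xⁿ`: nothing below weight `W`, the Taylor shift `P(Y − t)` on the weight line), hence `weightedOrder_subst_twist` and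
`flatPoly_inW_subst_twist` (Lemma 6.2.1 (4)/(5)'s bridge between `ord_{(y)}` and `ord_{(y₁)}`).  AI-written; gate-accepted = sorry-free, not refereed.
-/

set_option linter.dupNamespace false -- mandated namespace of this single-conjunct summit

noncomputable section

namespace Summit.ResolutionOfSingularities.ResolutionOfSingularities.Theorems

namespace WildMonic

open MvPowerSeries Polynomial

variable {k : Type} [Field k]

/-! ## Two letters -/

/-- An exponent in two letters (two distinct letters exhaust `Fin 2`: `Literature.AlgebraicGeometry.RealAlgebraic.eq_or_eq_of_ne`, inlined). -/
theorem finsupp_eq_single_add_single {x y : Fin 2} (hxy : x ≠ y) (e : Fin 2 →₀ ℕ) :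
    e = Finsupp.single x (e x) + Finsupp.single y (e y) := by
  ext l
  have hl : l = x ∨ l = y := by fin_cases x <;> fin_cases y <;> fin_cases l <;> simp_all
  rcases hl with rfl | rfl
  · simp [hxy.symm]
  · simp [hxy]

/-- The weight in two letters. -/
theorem weight_eq_of_letters {x y : Fin 2} (hxy : x ≠ y) (w : Fin 2 → ℕ) (e : Fin 2 →₀ ℕ) :
    Finsupp.weight w e = w x * e x + w y * e y := by
  rw [weight_fin_two]
  fin_cases x <;> fin_cases y <;> simp_all [add_comm]

/-- The weight for `w x = 1`, `w y = n`. -/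
theorem weight_eq {x y : Fin 2} (hxy : x ≠ y) {w : Fin 2 → ℕ} {n : ℕ} (hwx : w x = 1) (hwy : w y = n) (e : Fin 2 →₀ ℕ) :
    Finsupp.weight w e = e x + n * e y := by
  rw [weight_eq_of_letters hxy, hwx, hwy, one_mul]

/-- The weight `Pi.single y 1` reads the `y`-exponent. -/
theorem weight_single_one {x y : Fin 2} (hxy : x ≠ y) (e : Fin 2 →₀ ℕ) : Finsupp.weight (Pi.single y 1 : Fin 2 → ℕ) e = e y := by
  rw [weight_eq_of_letters hxy, Pi.single_eq_same, Pi.single_eq_of_ne hxy]; ring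

/-- Components of `single x a + single y b`. -/
theorem single_add_single_apply_x {x y : Fin 2} (hxy : x ≠ y) (a b : ℕ) :
    (Finsupp.single x a + Finsupp.single y b : Fin 2 →₀ ℕ) x = a := by
  simp [hxy.symm]

/-- Components of `single x a + single y b`. -/
theorem single_add_single_apply_y {x y : Fin 2} (hxy : x ≠ y) (a b : ℕ) :
    (Finsupp.single x a + Finsupp.single y b : Fin 2 →₀ ℕ) y = b := by
  simp [hxy]

/-- Components of `single y c + β`. -/
theorem single_add_apply_x {x y : Fin 2} (hxy : x ≠ y) (c : ℕ) (β : Fin 2 →₀ ℕ) :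
    (Finsupp.single y c + β : Fin 2 →₀ ℕ) x = β x := by
  simp [hxy]

/-- Components of `single y c + β`. -/
theorem single_add_apply_y (y : Fin 2) (c : ℕ) (β : Fin 2 →₀ ℕ) :
    (Finsupp.single y c + β : Fin 2 →₀ ℕ) y = c + β y := by
  simp

/-! ## Weighted homogeneous forms and their flattening -/

section Hom

variable {x y : Fin 2} (hxy : x ≠ y) {w : Fin 2 → ℕ} {n : ℕ} (hwx : w x = 1) (hwy : w y = n) (hn : 1 ≤ n)
  {G : MvPowerSeries (Fin 2) k} {W : ℕ} (hG : IsWeightedHomogeneous w G W)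

include hxy hwx hwy hG in
/-- An exponent in the support of a `w`-homogeneous form of weight `W` is `(W − n j, j)`. -/
theorem eq_single_add_single_of_coeff_ne_zero {e : Fin 2 →₀ ℕ} (he : coeff e G ≠ 0) :
    e x + n * e y = W ∧ e = Finsupp.single x (W - n * e y) + Finsupp.single y (e y) := by
  have hw : e x + n * e y = W := by rw [← weight_eq hxy hwx hwy]; exact hG he
  refine ⟨hw, ?_⟩
  conv_lhs => rw [finsupp_eq_single_add_single hxy e]
  congr 2
  omega

include hxy hwx hwy hn hG in
/-- The coefficients of a `w`-homogeneous form of weight `W` are those of its flattening. -/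
theorem coeff_eq_coeff_flatPoly (e : Fin 2 →₀ ℕ) :
    coeff e G = if e x + n * e y = W then (flatPoly x y n W G).coeff (e y) else 0 := by
  by_cases he : coeff e G = 0
  · rw [he]
    split_ifs with hw
    · rw [coeff_flatPoly, if_pos ((le_div_iff_mul_le' hn).mpr (by omega))]
      have : Finsupp.single x (W - n * e y) + Finsupp.single y (e y) = e := by
        rw [show W - n * e y = e x by omega]
        exact (finsupp_eq_single_add_single hxy e).symm
      rw [this, he]
    · rfl
  · obtain ⟨hw, heq⟩ := eq_single_add_single_of_coeff_ne_zero hxy hwx hwy hG he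
    rw [if_pos hw, coeff_flatPoly, if_pos ((le_div_iff_mul_le' hn).mpr (by omega)), ← heq]

include hn in
/-- The support of the flattening (for any series `G`). -/
theorem mem_support_flatPoly_iff (j : ℕ) :
    j ∈ (flatPoly x y n W G).support ↔ n * j ≤ W ∧ coeff (Finsupp.single x (W - n * j) + Finsupp.single y j) G ≠ 0 := by
  rw [Polynomial.mem_support_iff, coeff_flatPoly]
  constructor
  · intro h
    by_cases hj : j ≤ W / n
    · rw [if_pos hj] at h; exact ⟨(le_div_iff_mul_le' hn).mp hj, h⟩
    · rw [if_neg hj] at h; exact absurd rfl h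
  · rintro ⟨hj, h⟩
    rw [if_pos ((le_div_iff_mul_le' hn).mpr hj)]; exact h

include hxy hwx hwy hn hG in
/-- A `w`-homogeneous form vanishes iff its flattening does. -/
theorem flatPoly_eq_zero_iff : flatPoly x y n W G = 0 ↔ G = 0 := by
  constructor
  · intro h
    ext e
    rw [coeff_eq_coeff_flatPoly hxy hwx hwy hn hG, h, Polynomial.coeff_zero, ite_self, MvPowerSeries.coeff_zero]
  · rintro rfl
    ext j
    rw [coeff_flatPoly, Polynomial.coeff_zero]
    split_ifs <;> simp

include hxy hwx hwy hn hG in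
/-- THE `y`-ADIC ORDER IS THE TRAILING DEGREE OF THE FLATTENING (`ord_{(y)} G = tdeg P`). -/
theorem weightedOrder_single_eq_natTrailingDegree (hG0 : G ≠ 0) :
    G.weightedOrder (Pi.single y 1) = ((flatPoly x y n W G).natTrailingDegree : ℕ) := by
  have hP0 : flatPoly x y n W G ≠ 0 := fun h => hG0 ((flatPoly_eq_zero_iff hxy hwx hwy hn hG).mp h)
  rw [weightedOrder_eq_nat]
  constructor
  · have hmem := natTrailingDegree_mem_support_of_nonzero hP0
    rw [mem_support_flatPoly_iff hn] at hmem
    exact ⟨_, hmem.2, by rw [weight_single_one hxy, single_add_single_apply_y hxy]⟩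
  · intro e he
    rw [weight_single_one hxy] at he
    by_contra hne
    obtain ⟨hw, heq⟩ := eq_single_add_single_of_coeff_ne_zero hxy hwx hwy hG hne
    have hmem : e y ∈ (flatPoly x y n W G).support := by
      rw [mem_support_flatPoly_iff hn, ← heq]; exact ⟨by omega, hne⟩
    exact absurd (natTrailingDegree_le_of_mem_supp _ hmem) (not_le.mpr he)

/-- A weighted-homogeneous form is its own initial form. -/
theorem inW_eq_self_of_isWeightedHomogeneous (w : Fin 2 → ℕ) {G : MvPowerSeries (Fin 2) k} {W : ℕ} (hG : IsWeightedHomogeneous w G W)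
    (hG0 : G ≠ 0) : inW w G = G := by
  have hord : G.weightedOrder w = W := by
    rw [weightedOrder_eq_nat]
    refine ⟨?_, fun e he => hG.coeff_eq_zero (by intro h; rw [h] at he; exact lt_irrefl _ he)⟩
    have hex : ∃ e, coeff e G ≠ 0 := by
      by_contra hne
      push Not at hne
      exact hG0 (MvPowerSeries.ext fun e => by rw [hne e, MvPowerSeries.coeff_zero])
    obtain ⟨e, he⟩ := hex
    exact ⟨e, he, hG he⟩
  ext e
  rw [coeff_inW, hord, ENat.toNat_coe]
  split_ifs with h
  · rfl
  · exact (hG.coeff_eq_zero h).symm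

end Hom

/-- The flattening is additive. -/
theorem flatPoly_add (x y : Fin 2) (n W : ℕ) (F G : MvPowerSeries (Fin 2) k) :
    flatPoly x y n W (F + G) = flatPoly x y n W F + flatPoly x y n W G := by
  ext j
  simp only [coeff_flatPoly, Polynomial.coeff_add, map_add]
  split_ifs <;> simp

/-- The flattening of a scalar multiple. -/
theorem flatPoly_smul (x y : Fin 2) (n W : ℕ) (c : k) (F : MvPowerSeries (Fin 2) k) :
    flatPoly x y n W (c • F) = c • flatPoly x y n W F := by
  ext j
  simp only [coeff_flatPoly, Polynomial.coeff_smul, map_smul]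
  split_ifs <;> simp

/-- On the weight line `W = ord_w F`, the flattening of the initial form is the flattening of the series. -/
theorem flatPoly_inW {x y : Fin 2} (hxy : x ≠ y) {w : Fin 2 → ℕ} {n : ℕ} (hwx : w x = 1) (hwy : w y = n) {W : ℕ}
    (F : MvPowerSeries (Fin 2) k) (hW : (F.weightedOrder w).toNat = W) :
    flatPoly x y n W (inW w F) = flatPoly x y n W F := by
  ext j
  simp only [coeff_flatPoly, coeff_inW]
  split_ifs with hj hw
  · rfl
  · exfalso; apply hw
    rw [weight_eq hxy hwx hwy, single_add_single_apply_x hxy, single_add_single_apply_y hxy, hW]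
    have := Nat.div_mul_le_self W n
    have h2 : n * j ≤ n * (W / n) := Nat.mul_le_mul_left n hj
    rw [mul_comm n (W / n)] at h2
    omega
  · rfl

/-! ## Hasse derivatives in the flag letter -/

section Hasse

open Literature.RingTheory.MvPowerSeries

variable {x y : Fin 2} (hxy : x ≠ y) {w : Fin 2 → ℕ} {n : ℕ} (hwx : w x = 1) (hwy : w y = n) (hn : 1 ≤ n)

/-- The binomial of `hasseDeriv (single y k)`: `Π_s C(k δ_{sy} + β_s, k δ_{sy}) = C(k + β_y, k)`. -/
theorem prod_choose_single (y : Fin 2) (k' : ℕ) (β : Fin 2 →₀ ℕ) :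
    ((Finsupp.single y k' + β).prod fun s m => m.choose (Finsupp.single y k' s)) = (k' + β y).choose k' := by
  rw [prod_choose_eq, Fin.prod_univ_two]
  fin_cases y <;> simp

/-- Coefficients of the Hasse derivative in the flag letter: `[β] ∂_{y^k} F = C(β_y + k, k) · [β + k e_y] F`. -/
theorem coeff_hasseDeriv_single (y : Fin 2) (k' : ℕ) (F : MvPowerSeries (Fin 2) k) (β : Fin 2 →₀ ℕ) :
    coeff β (hasseDeriv (Finsupp.single y k') F) = (((β y + k').choose k' : ℕ) : k) * coeff (Finsupp.single y k' + β) F := by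
  rw [coeff_hasseDeriv, prod_choose_single, add_comm k' (β y)]

include hxy hwx hwy in
/-- `∂_{y^k}` of a `w`-homogeneous form of weight `W` is `w`-homogeneous of weight `W − n k`. -/
theorem isWeightedHomogeneous_hasseDeriv_single {G : MvPowerSeries (Fin 2) k} {W : ℕ} (hG : IsWeightedHomogeneous w G W) (k' : ℕ) :
    IsWeightedHomogeneous w (hasseDeriv (Finsupp.single y k') G) (W - n * k') := by
  intro β hβ
  rw [coeff_hasseDeriv_single] at hβ
  have h := hG (right_ne_zero_of_mul hβ)
  rw [weight_eq hxy hwx hwy, single_add_apply_x hxy, single_add_apply_y, Nat.mul_add] at h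
  rw [weight_eq hxy hwx hwy]
  omega

include hxy hn in
/-- THE FLATTENING OF `∂_{y^k} G` IS `∂_k` OF THE FLATTENING (`n k ≤ W`; any series `G`). -/
theorem flatPoly_hasseDeriv_single (G : MvPowerSeries (Fin 2) k) {W k' : ℕ} (hk : n * k' ≤ W) :
    flatPoly x y n (W - n * k') (hasseDeriv (Finsupp.single y k') G) = Polynomial.hasseDeriv k' (flatPoly x y n W G) := by
  ext j
  rw [coeff_flatPoly, Polynomial.hasseDeriv_coeff, coeff_flatPoly]
  have hidx : (j ≤ (W - n * k') / n ↔ j + k' ≤ W / n) := by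
    rw [le_div_iff_mul_le' hn, le_div_iff_mul_le' hn, Nat.mul_add]; omega
  by_cases hj : j ≤ (W - n * k') / n
  · have hexp : Finsupp.single y k' + (Finsupp.single x (W - n * k' - n * j) + Finsupp.single y j) =
        Finsupp.single x (W - n * (j + k')) + Finsupp.single y (j + k') := by
      rw [show W - n * (j + k') = W - n * k' - n * j by rw [Nat.mul_add]; omega, show j + k' = k' + j from add_comm _ _,
        Finsupp.single_add]
      abel
    rw [if_pos hj, if_pos (hidx.mp hj), coeff_hasseDeriv_single, single_add_single_apply_y hxy, hexp]
  · rw [if_neg hj, if_neg (fun h => hj (hidx.mpr h)), mul_zero]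

/-- LEMMA 6.2.1 (3) FOR SERIES: `ord_{(y)} F ≤ ord_{(y)} ∂_{y^k} F + k` — a Hasse derivative of order `k` in the letter `y` lowers the `y`-adic
order by at most `k`. -/
theorem weightedOrder_single_le_hasseDeriv_add {x y : Fin 2} (hxy : x ≠ y) (F : MvPowerSeries (Fin 2) k) (k' : ℕ) :
    F.weightedOrder (Pi.single y 1) ≤ (hasseDeriv (Finsupp.single y k') F).weightedOrder (Pi.single y 1) + k' := by
  by_cases hD : hasseDeriv (Finsupp.single y k') F = 0
  · rw [hD, weightedOrder_zero, top_add]; exact le_top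
  · have hfin : ((hasseDeriv (Finsupp.single y k') F).weightedOrder (Pi.single y 1)).toNat =
        (hasseDeriv (Finsupp.single y k') F).weightedOrder (Pi.single y 1) :=
      ENat.coe_toNat ((weightedOrder_eq_top_iff _).not.mpr hD)
    obtain ⟨β, hβ, hβw⟩ := exists_coeff_ne_zero_and_weightedOrder _ hfin
    rw [← hβw, weight_single_one hxy]
    rw [coeff_hasseDeriv_single] at hβ
    have h := weightedOrder_le (Pi.single y 1 : Fin 2 → ℕ) (right_ne_zero_of_mul hβ)
    rw [weight_single_one hxy, Finsupp.add_apply, Finsupp.single_eq_same] at h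
    calc F.weightedOrder (Pi.single y 1) ≤ ((k' + β y : ℕ) : ℕ∞) := h
      _ = (β y : ℕ∞) + k' := by push_cast; ring

end Hasse

/-! ## The twist to the subordinate coordinates -/

section Twist

variable {x y : Fin 2} (hxy : x ≠ y) {w : Fin 2 → ℕ} {n : ℕ} (hwx : w x = 1) (hwy : w y = n) (hn : 1 ≤ n) (t : k)

/-- The twist is Hauser–Perlega's triangular substitution `y ↦ y + φ(x)` with `φ = −t·xⁿ`. -/
theorem twist_eq_substFree :
    twist x y n t = fun l => if l = y then
        (X y : MvPowerSeries (Fin 2) k) + PowerSeries.subst (X x : MvPowerSeries (Fin 2) k) (PowerSeries.monomial n (-t))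
      else X l := by
  funext l
  by_cases hl : l = y
  · subst hl
    rw [if_pos rfl, twist_apply_self, ← Polynomial.coe_monomial, PowerSeries.subst_coe (PowerSeries.HasSubst.X x),
      Polynomial.aeval_monomial, ← MvPowerSeries.c_eq_algebraMap, map_neg, neg_mul, sub_eq_add_neg]
  · rw [if_neg hl, twist_apply_of_ne x y n t hl]

/-- The degree of the flattening is at most `W / n`. -/
theorem natDegree_flatPoly_le (x y : Fin 2) (n W : ℕ) (G : MvPowerSeries (Fin 2) k) : (flatPoly x y n W G).natDegree ≤ W / n := by
  rw [Polynomial.natDegree_le_iff_coeff_eq_zero]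
  intro N hN
  rw [coeff_flatPoly, if_neg (by exact_mod_cast not_le.mpr hN)]

include hxy hn in
/-- THE TWIST BELOW AND ON THE WEIGHT LINE (res-lit-5's `coeff_subst_triangular_of_weight_le` for `φ = −t xⁿ`): if every monomial of `F` has
weight `≥ W`, then `F(x, y₁ − t xⁿ)` has no monomial of weight `< W`, and on the weight line `W` it carries the Taylor shift `P(Y − t)` of the
flattening `P` of `F` (Hauser–Perlega: «`F = in_ω(F)(x, y₁ − t xⁿ) + K`, `ω₁(K) > ω₁(F)`»). -/
theorem coeff_subst_twist_of_weight_le (F : MvPowerSeries (Fin 2) k) {W : ℕ} (hW : ∀ d : Fin 2 →₀ ℕ, coeff d F ≠ 0 → W ≤ d x + n * d y)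
    (d : Fin 2 →₀ ℕ) (hd : d x + n * d y ≤ W) :
    coeff d (subst (twist x y n t) F) = if d x + n * d y = W then (taylor (-t) (flatPoly x y n W F)).coeff (d y) else 0 := by
  rw [twist_eq_substFree]
  have hlt : ∀ m, m < n → PowerSeries.coeff m (PowerSeries.monomial n (-t) : PowerSeries k) = 0 := fun m hm => by
    rw [PowerSeries.coeff_monomial, if_neg (Nat.ne_of_lt hm)]
  have heq : PowerSeries.coeff n (PowerSeries.monomial n (-t) : PowerSeries k) = -t := by
    rw [PowerSeries.coeff_monomial, if_pos rfl]
  exact Literature.AlgebraicGeometry.Resolution.HauserPerlega2024.coeff_subst_triangular_of_weight_le x y hxy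
    (fun l => by fin_cases x <;> fin_cases y <;> fin_cases l <;> simp_all) hn hlt heq F hW d hd

include hxy hwx hwy hn in
/-- THE TWIST KEEPS THE WEIGHTED ORDER: `ord_w F(x, y₁ − t xⁿ) = ord_w F` (the twist is `w`-homogeneous of weight `n` in the letter of weight `n`). -/
theorem weightedOrder_subst_twist {F : MvPowerSeries (Fin 2) k} (hF : F ≠ 0) :
    (subst (twist x y n t) F).weightedOrder w = F.weightedOrder w := by
  have hfin : F.weightedOrder w ≠ ⊤ := (weightedOrder_eq_top_iff w).not.mpr hF
  set W := (F.weightedOrder w).toNat with hWdef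
  have hWeq : F.weightedOrder w = W := (ENat.coe_toNat hfin).symm
  have hw : ∀ d : Fin 2 →₀ ℕ, coeff d F ≠ 0 → W ≤ d x + n * d y := fun d hd => by
    have h := weightedOrder_le w hd
    rw [hWeq, weight_eq hxy hwx hwy, Nat.cast_le] at h
    exact h
  rw [hWeq]
  apply le_antisymm
  · -- a surviving coefficient on the weight line
    have hhom : IsWeightedHomogeneous w (inW w F) W := isWeightedHomogeneous_inW w F
    have hP0 : flatPoly x y n W F ≠ 0 := by
      rw [← flatPoly_inW hxy hwx hwy F rfl]
      exact fun h => inW_ne_zero w hF ((flatPoly_eq_zero_iff hxy hwx hwy hn hhom).mp h)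
    have hT0 : taylor (-t) (flatPoly x y n W F) ≠ 0 := fun h => hP0 ((taylor_eq_zero _ _).mp h)
    obtain ⟨j, hj⟩ : ∃ j, (taylor (-t) (flatPoly x y n W F)).coeff j ≠ 0 := ⟨_, coeff_natTrailingDegree_ne_zero.mpr hT0⟩
    have hjle : n * j ≤ W := by
      have h1 : j ≤ (taylor (-t) (flatPoly x y n W F)).natDegree := le_natDegree_of_ne_zero hj
      rw [natDegree_taylor] at h1
      exact (le_div_iff_mul_le' hn).mp (h1.trans (natDegree_flatPoly_le x y n W F))
    set d : Fin 2 →₀ ℕ := Finsupp.single x (W - n * j) + Finsupp.single y j with hddef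
    have hdx : d x + n * d y = W := by rw [hddef, single_add_single_apply_x hxy, single_add_single_apply_y hxy]; omega
    have hcoeff : coeff d (subst (twist x y n t) F) ≠ 0 := by
      rw [coeff_subst_twist_of_weight_le hxy hn t F hw d hdx.le, if_pos hdx, hddef, single_add_single_apply_y hxy]
      exact hj
    have h := weightedOrder_le w hcoeff
    rw [weight_eq hxy hwx hwy, hdx] at h
    exact h
  · refine nat_le_weightedOrder w fun d hdw => ?_
    rw [weight_eq hxy hwx hwy] at hdw
    rw [coeff_subst_twist_of_weight_le hxy hn t F hw d hdw.le, if_neg (Nat.ne_of_lt hdw)]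

include hxy hwx hwy hn in
/-- A non-zero series stays non-zero under the twist. -/
theorem subst_twist_ne_zero {F : MvPowerSeries (Fin 2) k} (hF : F ≠ 0) : subst (twist x y n t) F ≠ 0 := by
  intro h
  have h1 := weightedOrder_subst_twist hxy hwx hwy hn t hF
  rw [h, weightedOrder_zero] at h1
  exact hF ((weightedOrder_eq_top_iff w).mp h1.symm)

include hxy hwx hwy hn in
/-- THE INITIAL FORM OF THE TWISTED SERIES FLATTENS TO THE TAYLOR SHIFT `P(Y − t)` of the flattening `P` of `in_w(F)` (`W = ord_w F`):
Lemma 6.2.1 (4)/(5)'s bridge between `ord_{(y)}` and `ord_{(y₁)}` — in the subordinate coordinates `(x, y₁)` the form `in_w(F)` reads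
`x^W · P(y₁/xⁿ − t)`. -/
theorem flatPoly_inW_subst_twist {F : MvPowerSeries (Fin 2) k} (hF : F ≠ 0) {W : ℕ} (hW : (F.weightedOrder w).toNat = W) :
    flatPoly x y n W (inW w (subst (twist x y n t) F)) = taylor (-t) (flatPoly x y n W (inW w F)) := by
  have hfin : F.weightedOrder w ≠ ⊤ := (weightedOrder_eq_top_iff w).not.mpr hF
  have hWeq : F.weightedOrder w = W := by rw [← hW]; exact (ENat.coe_toNat hfin).symm
  have hW' : ((subst (twist x y n t) F).weightedOrder w).toNat = W := by
    rw [weightedOrder_subst_twist hxy hwx hwy hn t hF, hW]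
  have hw : ∀ d : Fin 2 →₀ ℕ, coeff d F ≠ 0 → W ≤ d x + n * d y := fun d hd => by
    have h := weightedOrder_le w hd
    rw [hWeq, weight_eq hxy hwx hwy, Nat.cast_le] at h
    exact h
  rw [flatPoly_inW hxy hwx hwy _ hW', flatPoly_inW hxy hwx hwy _ hW]
  ext j
  rw [coeff_flatPoly]
  by_cases hj : j ≤ W / n
  · have hjn := (le_div_iff_mul_le' hn).mp hj
    rw [if_pos hj, coeff_subst_twist_of_weight_le hxy hn t F hw _
        (by rw [single_add_single_apply_x hxy, single_add_single_apply_y hxy]; omega),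
      if_pos (by rw [single_add_single_apply_x hxy, single_add_single_apply_y hxy]; omega), single_add_single_apply_y hxy]
  · rw [if_neg hj]
    symm
    apply coeff_eq_zero_of_natDegree_lt
    rw [natDegree_taylor]
    exact lt_of_le_of_lt (natDegree_flatPoly_le x y n W F) (not_le.mp hj)

end Twist

end WildMonic

end Summit.ResolutionOfSingularities.ResolutionOfSingularities.Theorems

end
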